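import Mathlib
import Literature.NumberTheory.LFunctions.Zhang2022.Section12Ded1217ErrorTerms
import HarnessLib

/-!
# Zhang (2022) §12: the `ε`-bookkeeping (12.13) → (12.14) → (12.15) — printed slacks versus the triangle inequality

Topic `Literature/NumberTheory/LFunctions/Zhang2022` (Landau–Siegel audit tree; verdict-neutral).
Y. Zhang, *Discrete mean estimates and the Landau–Siegel zero*, arXiv:2211.02515v1 (2022)
[Zhang2022LandauSiegel]. **Status of the source: an unrefereed manuscript under adjudication** (campaign D-0069, cell
siegel-zhang). Everything in this file is PROVED (theorems only; no new definitions, no new facts);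
nothing here is a claim about Theorems 1–2 of the source or about Landau–Siegel zeros.

Companion of the four `Section12Ded1217*` files (`Section12Ded1217.lean` proves (12.17) from (12.14),
(12.15), (12.16) AS TYPED). The manuscript writes its rounding quantities as "`ε`, `|ε| < 10⁻⁵`, not necessarily the same at
each occurrence" (§8 p. 50) and propagates them through §12 as `ε/10` (the two integrals of (12.13), p. 72),
`ε/4` ((12.14)), `ε/2` ((12.15), (12.16)), `ε` ((12.17)). This file kernel-checks that propagation against
the typed nodes of `TypedSection12C` (L3-t9) — GAP-LEDGER rows G-d38-1, G-d38-2 (campaign D-0069):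

* `eq1214_with_derived_slack : Eq1213 c′ → Step12u039 c′ → Step12u043 c′ → …` — (12.14) with the slack
  the triangle inequality actually yields from its printed inputs:
  `𝔞/(0.504 log P)·[(‖ι₃‖/0.498)(10⁻⁶ + 2·10⁻⁵∫|𝔣𝔣_{j6}|) + (‖ι₄‖/0.5)(10⁻⁶ + 2·10⁻⁵∫|𝔣𝔣_{j7}|)] + o(α)`;
  `printed_slack_1214_lt_derived` — the printed `10⁻⁵/4` is smaller than even the integral-free part
  `(‖ι₃‖/0.498 + ‖ι₄‖/0.5)·10⁻⁶` of that (certified: `ι₃ = −1.00635 − 0.22789i`, `ι₄ = −0.68738 + 1.60688i`,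
  (2.26)). So "`+ ε/4`" does not follow from the two "`+ ε/10`" by the stated means (it would with `0.557ε`).
* `eq1215_with_derived_slack : Eq1212 c′ → Mid1225 c′ → Eq1214 c′ → …` — (12.15) with slack `𝔞·10⁻⁵/(0.504π)`
  (`= 0.632·10⁻⁵𝔞`) from (12.14) AS TYPED; the main-term algebra is exact (`weighted_main1214_eq`:
  `Σ_j (w_j/α)·main₁₂.₁₄ = 𝔞e₂*` by `α log P = π`; `weighted_main1212_eq`: `Σ_j (w_j/α)·𝔞b*(log P)β_{j+1}β_{j+2}e*_{1j}
  = 𝔞e₁* + 𝔞b*πx(3xe*₁₁ + (36−30x)e*₁₂ + (12+15x)e*₁₃)`, `x = c′α𝓛`, from (2.13) verbatim; the remainder is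
  `O(𝔞𝓛⁻⁸) = o(1)` by `𝔞 ≪ 𝓛⁴`); `printed_slack_1215_lt_derived` — the printed `10⁻⁵/2` is smaller
  (`π < 3.97`). So "`ε/2`" does not follow from "`ε/4`" (it would with `0.632ε`; compounded from the `ε/10`
  level `≈ 1.41ε`, making the `ε` of (12.17) `≈ 2.8·10⁻⁵` instead of the `1e-5` typed in `Skeleton.Eval1217`).

Size: these are `10⁻⁵𝔞`-scale bookkeeping defects, immaterial against the `0.055`-scale failure of the §18
margin (`Skeleton.not_margin232`); they are recorded, not adjudicated, and say nothing about Theorems 1–2 of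
the source or about Landau–Siegel zeros. Which enclosures are TRUE (read1's prior: the `ε/10` claims fail
pointwise) is the num lane's N-07/N-08, not this file's.

## References

* Y. Zhang, arXiv:2211.02515v1 (2022), §12 pp. 71–73, (12.13)–(12.17); §8 p. 50 (the `ε` convention);
  (2.13), (2.26). [cite: Zhang2022LandauSiegel, §12 (12.13)–(12.15)]
-/

noncomputable section

open Complex Real ComplexConjugate
open Literature.NumberTheory.LFunctions.Zhang2022
open Literature.NumberTheory.LFunctions.Zhang2022.Skeleton
open Literature.NumberTheory.LFunctions.Zhang2022.Typed.Sec12A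
open Literature.NumberTheory.LFunctions.Zhang2022.Typed.Sec12C

namespace Literature.NumberTheory.LFunctions.Zhang2022.Sec12D

/-! ## The ε-flow (12.13) → (12.14) → (12.15): the printed slacks `ε/4`, `ε/2` versus the triangle inequality -/

section EpsFlow

variable (c' : ℝ) {D : ℕ} [NeZero D] (χ : DirichletCharacter ℂ D)

/-- Norms of the numerical literals `0.504, 0.498, 0.5 : ℂ`. [folklore] -/
private theorem norm_lits' : ‖(0.504 : ℂ)‖ = 0.504 ∧ ‖(0.498 : ℂ)‖ = 0.498 ∧ ‖(0.5 : ℂ)‖ = 0.5 := by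
  refine ⟨?_, ?_, ?_⟩
  · rw [show (0.504 : ℂ) = ((0.504 : ℝ) : ℂ) by norm_num, Complex.norm_real]; norm_num
  · rw [show (0.498 : ℂ) = ((0.498 : ℝ) : ℂ) by norm_num, Complex.norm_real]; norm_num
  · rw [show (0.5 : ℂ) = ((0.5 : ℝ) : ℂ) by norm_num, Complex.norm_real]; norm_num

/-- **(12.13) + u039 + u043 ⇒ (12.14) with the slack the triangle inequality actually gives.** From
`Eq1213` (second form, slack `10⁻⁵·maj`), `Step12u039` and `Step12u043` (the two "`… + ε/10`" enclosures,
`|ε| < 10⁻⁵`, typed as `10⁻⁶ + 10⁻⁵∫|𝔣𝔣|`), the sum over `P″₁ < dr < P₂` is `main1214 + O(slack) + o(α)` with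
`slack = 𝔞/(0.504 log P)·[(‖ι₃‖/0.498)(10⁻⁶ + 2·10⁻⁵∫|𝔣𝔣_{j6}|) + (‖ι₄‖/0.5)(10⁻⁶ + 2·10⁻⁵∫|𝔣𝔣_{j7}|)]` —
NOT the printed `𝔞/(0.504 log P)·10⁻⁵/4` of `Eq1214` (see `printed_slack_1214_lt_derived`). Kernel-checked
bookkeeping; no claim about which enclosure is true. [cite: Zhang2022LandauSiegel, §12 (12.14) p.72, tex L3656] -/
theorem eq1214_with_derived_slack (h1213 : Eq1213 c') (h039 : Step12u039 c') (h043 : Step12u043 c') :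
    ∀ ε : ℝ, 0 < ε → ForAllLarge fun D _ χ => AssumptionA D χ →
      ∀ a25 : ℕ → ℂ, (∀ n, a25 n = conj (χ (n : ZMod D) * vk13 D n)) →
        ∀ j ∈ ({1, 2, 3} : Finset ℕ),
          ‖SjOn c' D j (a12 χ) a25 (rngTop D) - main1214 χ‖ ≤
            frakA χ / (0.504 * Real.log (bigP D)) *
              (‖iota3‖ / 0.498 * (1e-6 + 2e-5 * ∫ z in (0.496:ℝ)..0.498, ‖ffj j 6 (0.498 - z)‖) +
                ‖iota4‖ / 0.5 * (1e-6 + 2e-5 * ∫ z in (0.496:ℝ)..0.5, ‖ffj j 7 (0.5 - z)‖)) +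
            ε * alpha D := by
  intro ε hε
  obtain ⟨D₀, hall⟩ := (((h1213 ε hε).and h039).and h043).and (forAllLarge_log_ge 1)
  refine ⟨D₀, fun D _ χ hD hq hp hA a25 ha25 j hj => ?_⟩
  obtain ⟨⟨⟨e1213, e039⟩, e043⟩, hlog1⟩ := hall D χ hD hq hp
  obtain ⟨n504, n498, n5⟩ := norm_lits'
  have hAf := frakA_nonneg χ
  have hlogpos : 0 < Real.log (bigP D) := by
    rw [logP_eq_pi_div_alpha hlog1]; exact div_pos Real.pi_pos (alpha_pos_of_log hlog1)
  have hT := (e1213 hA a25 ha25 j hj).2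
  have h6 := e039 j hj
  have h7 := e043 j hj
  set T := SjOn c' D j (a12 χ) a25 (rngTop D)
  set I6 := ∫ z in (0.496:ℝ)..0.498, ffj j 6 (0.498 - z) * frakw0 c' D j (bigP D ^ z)
  set I7 := ∫ z in (0.496:ℝ)..0.5, ffj j 7 (0.5 - z) * frakw0 c' D j (bigP D ^ z)
  set M6 := ∫ z in (0.496:ℝ)..0.498, ‖ffj j 6 (0.498 - z)‖
  set M7 := ∫ z in (0.496:ℝ)..0.5, ‖ffj j 7 (0.5 - z)‖
  set A3 : ℂ := (frakA χ : ℂ) * conj iota3 / (0.504 * 0.498 * (Real.log (bigP D) : ℂ)) with hA3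
  set A4 : ℂ := (frakA χ : ℂ) * conj iota4 / (0.504 * 0.5 * (Real.log (bigP D) : ℂ)) with hA4
  have hL : (Real.log (bigP D) : ℂ) ≠ 0 := by exact_mod_cast hlogpos.ne'
  -- the exact identity `main1213int − main1214 = A₃(I₆ + 0.002) + A₄(I₇ + 0.004 + πi/250²)`
  have hid : main1213int c' χ j - main1214 χ =
      A3 * (I6 + 0.002) + A4 * (I7 + 0.004 + π * I / 250 ^ 2) := by
    rw [main1213int, main1214, hA3, hA4]
    field_simp
    ring
  have nA3 : ‖A3‖ = frakA χ * ‖iota3‖ / (0.504 * 0.498 * Real.log (bigP D)) := by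
    rw [hA3, norm_div, norm_mul, norm_mul, norm_mul, Complex.norm_real, Complex.norm_real,
      Complex.norm_conj, Real.norm_of_nonneg hAf, Real.norm_of_nonneg hlogpos.le, n504, n498]
  have nA4 : ‖A4‖ = frakA χ * ‖iota4‖ / (0.504 * 0.5 * Real.log (bigP D)) := by
    rw [hA4, norm_div, norm_mul, norm_mul, norm_mul, Complex.norm_real, Complex.norm_real,
      Complex.norm_conj, Real.norm_of_nonneg hAf, Real.norm_of_nonneg hlogpos.le, n504, n5]
  have hmaj : maj1213int χ j = ‖A3‖ * M6 + ‖A4‖ * M7 := by rw [maj1213int, nA3, nA4]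
  have hdiff : ‖main1213int c' χ j - main1214 χ‖ ≤
      ‖A3‖ * (1e-6 + 1e-5 * M6) + ‖A4‖ * (1e-6 + 1e-5 * M7) := by
    rw [hid]
    calc ‖A3 * (I6 + 0.002) + A4 * (I7 + 0.004 + π * I / 250 ^ 2)‖
        ≤ ‖A3 * (I6 + 0.002)‖ + ‖A4 * (I7 + 0.004 + π * I / 250 ^ 2)‖ := norm_add_le _ _
      _ = ‖A3‖ * ‖I6 + 0.002‖ + ‖A4‖ * ‖I7 + 0.004 + π * I / 250 ^ 2‖ := by rw [norm_mul, norm_mul]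
      _ ≤ ‖A3‖ * (1e-6 + 1e-5 * M6) + ‖A4‖ * (1e-6 + 1e-5 * M7) := by gcongr
  have key : ‖T - main1214 χ‖ ≤ ‖T - main1213int c' χ j‖ + ‖main1213int c' χ j - main1214 χ‖ :=
    norm_sub_le_norm_sub_add_norm_sub _ _ _
  have e : frakA χ / (0.504 * Real.log (bigP D)) *
        (‖iota3‖ / 0.498 * (1e-6 + 2e-5 * M6) + ‖iota4‖ / 0.5 * (1e-6 + 2e-5 * M7)) =
      1e-5 * (‖A3‖ * M6 + ‖A4‖ * M7) + (‖A3‖ * (1e-6 + 1e-5 * M6) + ‖A4‖ * (1e-6 + 1e-5 * M7)) := by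
    rw [nA3, nA4]
    field_simp
    ring
  rw [e]
  rw [hmaj] at hT
  linarith

omit [NeZero D] in
/-- **The printed slack of (12.14) is SMALLER than what the triangle inequality gives from its printed
inputs**: already the integral-free part `(‖ι₃‖/0.498 + ‖ι₄‖/0.5)·10⁻⁶` of the derived slack exceeds the
printed `10⁻⁵/4` (`‖ι₃‖ ≥ |Re ι₃| = 1.00635`, `‖ι₄‖ ≥ |Im ι₄| = 1.60688`: `2.0208 + 3.2138 = 5.23 > 2.5`, in units of
`10⁻⁶·𝔞/(0.504 log P)`). So "`+ ε/4`" in (12.14) does not follow from the two "`+ ε/10`" of (12.13) by the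
stated means (it follows with `0.557ε`); a bookkeeping observation of size `10⁻⁶𝔞α`, recorded for the
GAP-LEDGER, not an adjudication. [cite: Zhang2022LandauSiegel, §12 (12.14) p.72, tex L3656] -/
theorem printed_slack_1214_lt_derived :
    (1e-5 : ℝ) / 4 < (‖iota3‖ / 0.498 + ‖iota4‖ / 0.5) * 1e-6 := by
  have h3 : (1.00635 : ℝ) ≤ ‖iota3‖ := by
    have := Complex.abs_re_le_norm iota3
    have hre : iota3.re = -1.00635 := by simp [iota3]
    rw [hre] at this
    have : |(-1.00635 : ℝ)| = 1.00635 := by norm_num [abs_of_neg]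
    linarith
  have h4 : (1.60688 : ℝ) ≤ ‖iota4‖ := by
    have := Complex.abs_im_le_norm iota4
    have him : iota4.im = 1.60688 := by simp [iota4]
    rw [him] at this
    have : |(1.60688 : ℝ)| = 1.60688 := by norm_num
    linarith
  calc (1e-5 : ℝ) / 4 < (1.00635 / 0.498 + 1.60688 / 0.5) * 1e-6 := by norm_num
    _ ≤ (‖iota3‖ / 0.498 + ‖iota4‖ / 0.5) * 1e-6 := by gcongr

/-- **The printed slack of (12.15) is SMALLER than what (12.12) + (12.14) give**: summing (12.14)'s
`𝔞/(0.504 log P)·ε/4` over `j` with the weights `1/(2α), 2/α, 3/(2α)` (total `4/α`, and `α log P = π`) gives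
`𝔞·ε/(0.504π)`, i.e. `0.632·10⁻⁵𝔞`, not the printed `𝔞·ε/2 = 0.5·10⁻⁵𝔞`: `10⁻⁵/2 < 10⁻⁵/(0.504π)` (`π < 3.97`).
(Compounded from the `ε/10` level of (12.13) the honest slack of (12.15) is `≈ 1.41·10⁻⁵𝔞`, and the `ε` of (12.17)
becomes `≈ 2.8·10⁻⁵` — above the `1e-5` slack typed in `Skeleton.Eval1217`; immaterial in size against the
margin at `Margin232`.) A bookkeeping observation for the GAP-LEDGER, not an adjudication.
[cite: Zhang2022LandauSiegel, §12 (12.15) p.72, tex L3660] -/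
theorem printed_slack_1215_lt_derived : (1e-5 : ℝ) / 2 < 1e-5 / (0.504 * π) := by
  have hπ := Real.pi_lt_d2
  have hπ0 := Real.pi_pos
  rw [div_lt_div_iff_of_pos_left (by norm_num) (by norm_num) (by positivity)]
  nlinarith

end EpsFlow

section EpsFlow2

variable (c' : ℝ) {D : ℕ} [NeZero D] (χ : DirichletCharacter ℂ D)

omit [NeZero D] in
/-- The index convention of `β_j` at the values used in §12: `β₂, β₃, β₄ = β₁, β₅ = β₂`.
[cite: Zhang2022LandauSiegel, §8 p. 45] -/
theorem betaJ_vals (D : ℕ) : betaJ c' D 2 = beta2 c' D ∧ betaJ c' D 3 = beta3 c' D ∧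
    betaJ c' D 4 = beta1 c' D ∧ betaJ c' D 5 = beta2 c' D := by
  refine ⟨?_, ?_, ?_, ?_⟩ <;> simp [betaJ]

omit [NeZero D] in
/-- The three products `β₂β₃, β₃β₁, β₁β₂` in terms of `α` and the perturbation `x = c′α𝓛` of (2.13):
`−6α²(1+x)(1−x)`, `−3α²(1−x)(1−5x)`, `−2α²(1−5x)(1+x)`. [cite: Zhang2022LandauSiegel, §2 (2.13)] -/
theorem beta_products (D : ℕ) :
    beta2 c' D * beta3 c' D =
        -6 * (alpha D : ℂ) ^ 2 * ((1 + c' * alpha D * ell D : ℝ) : ℂ) * ((1 - c' * alpha D * ell D : ℝ) : ℂ) ∧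
      beta3 c' D * beta1 c' D =
        -3 * (alpha D : ℂ) ^ 2 * ((1 - c' * alpha D * ell D : ℝ) : ℂ) *
          ((1 - 5 * c' * alpha D * ell D : ℝ) : ℂ) ∧
      beta1 c' D * beta2 c' D =
        -2 * (alpha D : ℂ) ^ 2 * ((1 - 5 * c' * alpha D * ell D : ℝ) : ℂ) *
          ((1 + c' * alpha D * ell D : ℝ) : ℂ) := by
  refine ⟨?_, ?_, ?_⟩
  · rw [beta2, beta3]; ring_nf; rw [Complex.I_sq]; ring
  · rw [beta3, beta1]; ring_nf; rw [Complex.I_sq]; ring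
  · rw [beta1, beta2]; ring_nf; rw [Complex.I_sq]; ring

/-- The linear bookkeeping of "(12.12) + middle + (12.14) ⇒ (12.15)": if each `S_j = L_j + M_j + T_j` with
`‖L_j − m_j‖, ‖M_j‖ ≤ ε₁α`, `‖T_j − m‖ ≤ q + ε₁α`, and the weighted main terms are `E₁ + R` and `E₂`, then the
weighted sum is `E₁ + E₂` within `4q/α + 12ε₁ + ‖R‖`. [cite: Zhang2022LandauSiegel, §12 (12.15) p.72] -/
theorem weighted_sum_slack {α ε₁ q : ℝ} (hα : 0 < α)
    {S1 S2 S3 L1 M1 T1 L2 M2 T2 L3 M3 T3 m1 m2 m3 m E1 E2 R : ℂ}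
    (hS1 : S1 = L1 + M1 + T1) (hS2 : S2 = L2 + M2 + T2) (hS3 : S3 = L3 + M3 + T3)
    (r1L : ‖L1 - m1‖ ≤ ε₁ * α) (r1M : ‖M1‖ ≤ ε₁ * α) (r1T : ‖T1 - m‖ ≤ q + ε₁ * α)
    (r2L : ‖L2 - m2‖ ≤ ε₁ * α) (r2M : ‖M2‖ ≤ ε₁ * α) (r2T : ‖T2 - m‖ ≤ q + ε₁ * α)
    (r3L : ‖L3 - m3‖ ≤ ε₁ * α) (r3M : ‖M3‖ ≤ ε₁ * α) (r3T : ‖T3 - m‖ ≤ q + ε₁ * α)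
    (hmain12 : (1 / (2 * α) * m1 + 2 / α * m2 + 3 / (2 * α) * m3 : ℂ) = E1 + R)
    (hmain14 : (1 / (2 * α) * m + 2 / α * m + 3 / (2 * α) * m : ℂ) = E2) :
    ‖(1 / (2 * α) * S1 + 2 / α * S2 + 3 / (2 * α) * S3 : ℂ) - (E1 + E2)‖ ≤
      4 * q / α + 12 * ε₁ + ‖R‖ := by
  have key : (1 / (2 * α) * S1 + 2 / α * S2 + 3 / (2 * α) * S3 : ℂ) - (E1 + E2) =
      (1 / (2 * α) * ((L1 - m1) + M1 + (T1 - m)) + 2 / α * ((L2 - m2) + M2 + (T2 - m)) +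
        3 / (2 * α) * ((L3 - m3) + M3 + (T3 - m)) : ℂ) + R := by
    rw [hS1, hS2, hS3]
    linear_combination hmain12 + hmain14
  rw [key]
  have nα1 : ‖(1 / (2 * α) : ℂ)‖ = 1 / (2 * α) := by
    rw [show (1 / (2 * α) : ℂ) = ((1 / (2 * α) : ℝ) : ℂ) by push_cast; ring,
      Complex.norm_real, Real.norm_of_nonneg (by positivity)]
  have nα2 : ‖(2 / α : ℂ)‖ = 2 / α := by
    rw [show (2 / α : ℂ) = ((2 / α : ℝ) : ℂ) by push_cast; ring,
      Complex.norm_real, Real.norm_of_nonneg (by positivity)]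
  have nα3 : ‖(3 / (2 * α) : ℂ)‖ = 3 / (2 * α) := by
    rw [show (3 / (2 * α) : ℂ) = ((3 / (2 * α) : ℝ) : ℂ) by push_cast; ring,
      Complex.norm_real, Real.norm_of_nonneg (by positivity)]
  have b1 : ‖(L1 - m1) + M1 + (T1 - m)‖ ≤ 3 * (ε₁ * α) + q := (norm_add₃_le).trans (by linarith)
  have b2 : ‖(L2 - m2) + M2 + (T2 - m)‖ ≤ 3 * (ε₁ * α) + q := (norm_add₃_le).trans (by linarith)
  have b3 : ‖(L3 - m3) + M3 + (T3 - m)‖ ≤ 3 * (ε₁ * α) + q := (norm_add₃_le).trans (by linarith)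
  calc ‖(1 / (2 * α) * ((L1 - m1) + M1 + (T1 - m)) + 2 / α * ((L2 - m2) + M2 + (T2 - m)) +
          3 / (2 * α) * ((L3 - m3) + M3 + (T3 - m)) : ℂ) + R‖
      ≤ ‖(1 / (2 * α) * ((L1 - m1) + M1 + (T1 - m)) + 2 / α * ((L2 - m2) + M2 + (T2 - m)) +
          3 / (2 * α) * ((L3 - m3) + M3 + (T3 - m)) : ℂ)‖ + ‖R‖ := norm_add_le _ _
    _ ≤ (1 / (2 * α) * (3 * (ε₁ * α) + q) + 2 / α * (3 * (ε₁ * α) + q) +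
          3 / (2 * α) * (3 * (ε₁ * α) + q)) + ‖R‖ := by
        gcongr
        refine (norm_add₃_le).trans ?_
        rw [norm_mul, norm_mul, norm_mul, nα1, nα2, nα3]
        gcongr
    _ = 4 * q / α + 12 * ε₁ + ‖R‖ := by field_simp; ring

/-- The remainder of the `β`-algebra is small: `‖𝔞b*πx(3xe*₁₁ + (36−30x)e*₁₂ + (12+15x)e*₁₃)‖ ≤ 𝔞|x|K₁`,
`|x| ≤ |c′|π`. [cite: Zhang2022LandauSiegel, §12 (12.15) p.72] -/
theorem norm_beta_remainder_le {A x : ℝ} (hA : 0 ≤ A) {c : ℝ} (hx : |x| ≤ c) :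
    ‖(A : ℂ) * bstar * π * x *
        (3 * x * estar1j 1 + (36 - 30 * x) * estar1j 2 + (12 + 15 * x) * estar1j 3)‖ ≤
      A * |x| * (‖bstar‖ * π * (3 * c * ‖estar1j 1‖ + (36 + 30 * c) * ‖estar1j 2‖ +
        (12 + 15 * c) * ‖estar1j 3‖)) := by
  have hπ := Real.pi_pos
  have hc : 0 ≤ c := (abs_nonneg x).trans hx
  have e : (A : ℂ) * bstar * π * x *
      (3 * x * estar1j 1 + (36 - 30 * x) * estar1j 2 + (12 + 15 * x) * estar1j 3) =
      (A : ℂ) * (x : ℂ) * (bstar * π *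
        (3 * x * estar1j 1 + (36 - 30 * x) * estar1j 2 + (12 + 15 * x) * estar1j 3)) := by ring
  rw [e, norm_mul, norm_mul, Complex.norm_real, Complex.norm_real, Real.norm_of_nonneg hA,
    Real.norm_eq_abs]
  refine mul_le_mul_of_nonneg_left ?_ (by positivity)
  rw [norm_mul, norm_mul, Complex.norm_real, Real.norm_of_nonneg hπ.le]
  refine mul_le_mul_of_nonneg_left ?_ (by positivity)
  have n1 : ‖3 * (x : ℂ) * estar1j 1‖ ≤ 3 * c * ‖estar1j 1‖ := by
    rw [norm_mul, norm_mul, Complex.norm_real, Real.norm_eq_abs]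
    have : ‖(3 : ℂ)‖ = 3 := by simp
    rw [this]; gcongr
  have n2 : ‖(36 - 30 * (x : ℂ)) * estar1j 2‖ ≤ (36 + 30 * c) * ‖estar1j 2‖ := by
    rw [norm_mul]
    refine mul_le_mul_of_nonneg_right ?_ (norm_nonneg _)
    calc ‖(36 - 30 * (x : ℂ))‖ ≤ ‖(36 : ℂ)‖ + ‖30 * (x : ℂ)‖ := norm_sub_le _ _
      _ = 36 + 30 * |x| := by rw [norm_mul, Complex.norm_real, Real.norm_eq_abs]; norm_num
      _ ≤ 36 + 30 * c := by gcongr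
  have n3 : ‖(12 + 15 * (x : ℂ)) * estar1j 3‖ ≤ (12 + 15 * c) * ‖estar1j 3‖ := by
    rw [norm_mul]
    refine mul_le_mul_of_nonneg_right ?_ (norm_nonneg _)
    calc ‖(12 + 15 * (x : ℂ))‖ ≤ ‖(12 : ℂ)‖ + ‖15 * (x : ℂ)‖ := norm_add_le _ _
      _ = 12 + 15 * |x| := by rw [norm_mul, Complex.norm_real, Real.norm_eq_abs]; norm_num
      _ ≤ 12 + 15 * c := by gcongr
  exact (norm_add₃_le).trans (by linarith)

/-- `Σ_j (w_j/α)·main1214 = 𝔞e₂*` exactly (`w = ½, 2, 3/2`; `α log P = π`). [cite: Zhang2022LandauSiegel, §12 (12.15) p.72] -/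
theorem weighted_main1214_eq (hD : 1 ≤ Real.log D) :
    (1 / (2 * alpha D) * main1214 χ + 2 / alpha D * main1214 χ +
      3 / (2 * alpha D) * main1214 χ : ℂ) = frakA χ * e2star := by
  have hαC : (alpha D : ℂ) ≠ 0 := by exact_mod_cast (alpha_pos_of_log hD).ne'
  rw [main1214, e2star, logP_eq_pi_div_alpha hD]
  push_cast
  field_simp
  ring

/-- `Σ_j (w_j/α)·main1212int_j = 𝔞e₁* + 𝔞b*πx(3xe*₁₁ + (36−30x)e*₁₂ + (12+15x)e*₁₃)` exactly, `x = c′α𝓛`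
((2.13): `β₂β₃ log P = −6πα(1−x²)`, `β₃β₁ log P = −3πα(1−x)(1−5x)`, `β₁β₂ log P = −2πα(1−5x)(1+x)`).
[cite: Zhang2022LandauSiegel, §12 (12.15) p.72] -/
theorem weighted_main1212_eq (hD : 1 ≤ Real.log D) :
    (1 / (2 * alpha D) * main1212int c' χ 1 + 2 / alpha D * main1212int c' χ 2 +
      3 / (2 * alpha D) * main1212int c' χ 3 : ℂ) = frakA χ * e1star +
      (frakA χ : ℂ) * bstar * π * ((c' * alpha D * ell D : ℝ) : ℂ) *
        (3 * ((c' * alpha D * ell D : ℝ) : ℂ) * estar1j 1 +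
          (36 - 30 * ((c' * alpha D * ell D : ℝ) : ℂ)) * estar1j 2 +
          (12 + 15 * ((c' * alpha D * ell D : ℝ) : ℂ)) * estar1j 3) := by
  have hαC : (alpha D : ℂ) ≠ 0 := by exact_mod_cast (alpha_pos_of_log hD).ne'
  obtain ⟨b2, b3, b4, b5⟩ := betaJ_vals c' D
  obtain ⟨p23, p31, p12⟩ := beta_products c' D
  have m1 : main1212int c' χ 1 = frakA χ * bstar * Real.log (bigP D) * (beta2 c' D * beta3 c' D) *
      estar1j 1 := by simp only [main1212int]; norm_num [b2, b3]
  have m2 : main1212int c' χ 2 = frakA χ * bstar * Real.log (bigP D) * (beta3 c' D * beta1 c' D) *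
      estar1j 2 := by simp only [main1212int]; norm_num [b3, b4]
  have m3 : main1212int c' χ 3 = frakA χ * bstar * Real.log (bigP D) * (beta1 c' D * beta2 c' D) *
      estar1j 3 := by simp only [main1212int]; norm_num [b4, b5]
  rw [m1, m2, m3, p23, p31, p12, e1star_eq_estar1j, logP_eq_pi_div_alpha hD]
  push_cast
  field_simp
  ring

/-- The `o(1)` arithmetic of the remainder: `A·(c𝓛⁻⁸)·K ≤ ε/2` once `A ≤ A₀𝓛⁴` and `𝓛 ≥ 2A₀cK/ε + 1`.
[cite: Zhang2022LandauSiegel, §12 (12.15) p.72] -/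
theorem remainder_small {A A₀ c K ℓ ε : ℝ} (hℓ : 1 ≤ ℓ) (hA0 : 0 ≤ A) (hA : A ≤ A₀ * ℓ ^ 4)
    (hc : 0 ≤ c) (hK : 0 ≤ K) (hε : 0 < ε) (hb : 2 * A₀ * c * K / ε + 1 ≤ ℓ) :
    A * (c * (ℓ ^ 8)⁻¹) * K ≤ ε / 2 := by
  have hℓ0 : 0 < ℓ := by linarith
  have hA₀ : 0 ≤ A₀ := by nlinarith [pow_pos hℓ0 4]
  have h1 : A * (c * (ℓ ^ 8)⁻¹) * K ≤ A₀ * ℓ ^ 4 * (c * (ℓ ^ 8)⁻¹) * K := by gcongr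
  have h2 : A₀ * ℓ ^ 4 * (c * (ℓ ^ 8)⁻¹) * K = A₀ * c * K / ℓ ^ 4 := by field_simp
  have hb' : 2 * A₀ * c * K ≤ ε * ℓ := by
    have := (div_le_iff₀ hε).mp (show 2 * A₀ * c * K / ε ≤ ℓ by linarith); linarith
  have hℓ4 : ℓ ≤ ℓ ^ 4 := by
    calc ℓ = ℓ ^ 1 := (pow_one _).symm
      _ ≤ ℓ ^ 4 := pow_le_pow_right₀ hℓ (by norm_num)
  have h3 : A₀ * c * K / ℓ ^ 4 ≤ ε / 2 := by
    rw [div_le_iff₀ (by positivity)]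
    nlinarith [mul_nonneg (mul_nonneg hA₀ hc) hK]
  linarith

/-- **(12.12) + middle range + (12.14) ⇒ (12.15) with the slack the triangle inequality actually gives**:
`‖(2α)⁻¹S₁ + 2α⁻¹S₂ + (3/2α)S₃ − 𝔞(e₁* + e₂*)‖ ≤ 𝔞·10⁻⁵/(0.504π) + o(1)` — from `Eq1212` (second form),
`Mid1225`, `Eq1214` AS TYPED. The main-term algebra is EXACT (`weighted_main1214_eq`, `weighted_main1212_eq`,
from (2.13) verbatim), the remainder being `O(𝔞𝓛⁻⁸) = O(𝓛⁻⁴) = o(1)`. The printed slack is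
`𝔞·10⁻⁵/2 < 𝔞·10⁻⁵/(0.504π)` (`printed_slack_1215_lt_derived`). Kernel-checked bookkeeping.
[cite: Zhang2022LandauSiegel, §12 (12.15) p.72, tex L3660] -/
theorem eq1215_with_derived_slack (h1212 : Eq1212 c') (hMid : Mid1225 c') (h1214 : Eq1214 c') :
    ∀ ε : ℝ, 0 < ε → ForAllLarge fun D _ χ => AssumptionA D χ →
      ∀ a25 : ℕ → ℂ, (∀ n, a25 n = conj (χ (n : ZMod D) * vk13 D n)) →
        ‖(1 / (2 * alpha D) * Sj c' D 1 (a12 χ) a25 + 2 / alpha D * Sj c' D 2 (a12 χ) a25 +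
              3 / (2 * alpha D) * Sj c' D 3 (a12 χ) a25 : ℂ) - frakA χ * (e1star + e2star)‖ ≤
          frakA χ * (1e-5 / (0.504 * π)) + ε := by
  intro ε hε
  set K₁ : ℝ := ‖bstar‖ * π * (3 * (|c'| * π) * ‖estar1j 1‖ + (36 + 30 * (|c'| * π)) * ‖estar1j 2‖ +
    (12 + 15 * (|c'| * π)) * ‖estar1j 3‖) with hK₁
  set A₀ : ℝ := 96 * Real.exp 9 / π ^ 2 with hA₀
  have hπ := Real.pi_pos
  have hK₁0 : 0 ≤ K₁ := by positivity
  have hε₁0 : 0 < ε / 24 := by positivity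
  obtain ⟨D₀, hall⟩ := (((h1212 (ε / 24) hε₁0).and (hMid (ε / 24) hε₁0)).and (h1214 (ε / 24) hε₁0)).and
    (forAllLarge_log_ge (max 4 (2 * A₀ * (|c'| * π) * K₁ / ε + 1)))
  refine ⟨D₀, fun D _ χ hD hq hp hA a25 ha25 => ?_⟩
  obtain ⟨⟨⟨e1212, eMid⟩, e1214⟩, hlog⟩ := hall D χ hD hq hp
  have hlog4 : 4 ≤ Real.log D := le_trans (le_max_left _ _) hlog
  have hlogK : 2 * A₀ * (|c'| * π) * K₁ / ε + 1 ≤ Real.log D := le_trans (le_max_right _ _) hlog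
  have hD1 : 1 ≤ Real.log D := by linarith
  have hℓ1 : 1 ≤ ell D := by rw [ell]; exact hD1
  have hα := alpha_pos_of_log (D := D) hD1
  have hAf := frakA_nonneg χ
  -- the nine range inequalities at `ε/24`
  have r1L := (e1212 hA a25 ha25 1 (by simp)).2
  have r2L := (e1212 hA a25 ha25 2 (by simp)).2
  have r3L := (e1212 hA a25 ha25 3 (by simp)).2
  have r1M := eMid hA a25 ha25 1 (by simp)
  have r2M := eMid hA a25 ha25 2 (by simp)
  have r3M := eMid hA a25 ha25 3 (by simp)
  have r1T := e1214 hA a25 ha25 1 (by simp)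
  have r2T := e1214 hA a25 ha25 2 (by simp)
  have r3T := e1214 hA a25 ha25 3 (by simp)
  rw [prefactor1214_eq χ hD1] at r1T r2T r3T
  -- the weighted sum
  have W := weighted_sum_slack hα (Sj_a12_split c' χ hlog4 1 a25) (Sj_a12_split c' χ hlog4 2 a25)
    (Sj_a12_split c' χ hlog4 3 a25) r1L r1M r1T r2L r2M r2T r3L r3M r3T
    (weighted_main1212_eq c' χ hD1) (weighted_main1214_eq χ hD1)
  -- the remainder is `o(1)`
  have hxabs : |c' * alpha D * ell D| ≤ |c'| * π := abs_pert_le c' hD1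
  have hxeq : |c' * alpha D * ell D| = |c'| * (π * (ell D ^ 8)⁻¹) := by
    rw [mul_assoc, abs_mul, abs_of_nonneg (mul_nonneg hα.le (by linarith)), alpha_mul_ell_eq hD1]
  have hR := norm_beta_remainder_le (A := frakA χ) hAf hxabs
  rw [hxeq] at hR
  have hRs : frakA χ * (|c'| * (π * (ell D ^ 8)⁻¹)) * K₁ ≤ ε / 2 := by
    have := remainder_small (A := frakA χ) (A₀ := A₀) (c := |c'| * π) (K := K₁) hℓ1 hAf
      (frakA_le_ell_pow_four χ (by linarith) hp) (by positivity) hK₁0 hε (by rw [ell]; linarith)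
    simpa [mul_assoc] using this
  have e4 : 4 * (frakA χ * alpha D / (0.504 * π) * (1e-5 / 4)) / alpha D =
      frakA χ * (1e-5 / (0.504 * π)) := by
    field_simp
  rw [mul_add (frakA χ : ℂ)]
  refine W.trans ?_
  rw [e4]
  linarith

end EpsFlow2

end Literature.NumberTheory.LFunctions.Zhang2022.Sec12D
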